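import Mathlib
import Summits.Ventures.HodgeRepro2.Tier7.Line3.AdicCompletionLevel
import Summits.Ventures.HodgeRepro2.Tier7.Line3.AdicCompletionRestrictionDegree

/-!
# Tier7/Line3/InertLevelBase — the other half of «`v₁` inert» consumed: the level read from the base field, `f = 2`
(seat t7-x1, gen 5; ASSEMBLY-p4.md §3 row 2's in-words half typed)

LINE 3 (t7-plan-3), version (ii). The level-place assembly (LevelPlaceAssembly p706778, §3 form) displays the place
datum `(K, E, v, w, [w.asIdeal.LiesOver v.asIdeal], hone : ncard (primesOver v.asIdeal (𝓞 E)) = 1)`; the kernel's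
`ncard = 1` is the «ONE PRIME ABOVE `v`» half of «`v₁` inert» and admits a ramified `w` (`e = 2`); the other half —
«`v₁` is inert (`e = 1`, `f = 2`), so `𝔭_{v₁} 𝓞_{E_w} = 𝔭_w` and the real level `𝔭_{v₁}^{N+1}` of the datum's `K_N` is
the kernel's `levelTower N` at `q := q w`» — stayed in words (plan-3 STATUS l. 15913 (1b); the hσσ ruling l. 15863 (2):
«`ramificationIdx = 1` would be consumed by nothing: decoration»). This module CONSUMES `e = 1`:

* `intValuation_algebraMap_eq` (`he : v.asIdeal.ramificationIdx' w.asIdeal = 1` DISPLAYED):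
  `w.intValuation (algebraMap (𝓞 K) (𝓞 E) x) = v.intValuation x` — Mathlib's `intValuation_liesOver` at `e = 1`;
* `mem_pow_iff : algebraMap (𝓞 K) (𝓞 E) x ∈ w.asIdeal ^ n ↔ x ∈ v.asIdeal ^ n` («`𝔭_{v₁}^n 𝓞_E ∩ 𝓞_{E⁺} = 𝔭_{v₁}^n` at
  the global integers», `intValuation_le_pow_iff_dvd` on both sides);
* `valued_coe_le_pow_iff_base : Valued.v ((algebraMap (𝓞 K) (𝓞 E) x : E) : w.adicCompletion E) ≤ exp (−n) ↔
  x ∈ v.asIdeal ^ n` (AdicCompletionLevel.valued_coe_le_pow_iff at `K := E`, `v := w`);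
* THE CONSUMER `mem_levelTower_iff_of_integral_base`: for `g ∈ GL₂(E_w)` whose `g − 1` has entries the images of a
  matrix `m` over `𝓞 K`, `g ∈ levelTower normAbv _ (one_lt_q w) N ↔ ∀ i j, m i j ∈ v.asIdeal ^ (N+1)` — the kernel's
  level-`N` group at `q := q w` IS the principal congruence subgroup of level `𝔭_{v₁}^{N+1}` read in the BASE field;
* `q_eq_pow_inertiaDeg : q w = (q v) ^ f` (AdicCompletionRestriction.absNorm_eq_pow), and with `hone` and
  `hdeg : Module.finrank K E = 2`: `inertiaDeg_eq_two : f = 2` (`e · f = [E : K]`,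
  AdicCompletionRestrictionDegree.localDeg_eq_finrank) and `q_eq_sq : q w = (q v) ^ 2` — the [W] table's
  «`q w = N(v)^f` (`f = 2` at the inert `v₁`)» as theorems.

* `valued_uniformizer_eq` / `mem_levelTower_iff_valued_le_pow_uniformizer` (L1-p4 STATUS l. 16124 P1): a uniformiser
  `ϖ` of `K` at `v` stays one of `E_w` (`e = 1`), and for EVERY `g ∈ GL₂(E_w)` — no integrality restriction on the
  entries — `g ∈ K_N ↔ ∀ i j, Valued.v ((g − 1) i j) ≤ Valued.v (ϖ : E_w) ^ (N+1)`: «`g ≡ 1 (mod 𝔭_{v₁}^{N+1} 𝓞_{E,w})`»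
  read through the base uniformiser.

WHAT THIS CHANGES IN THE [W] COLUMN: the in-words half of «`v₁` inert» becomes a DISPLAYED datum `e = 1` consumed by
the level identification (base-field entries: `mem_levelTower_iff_of_integral_base`; every entry, through a base
uniformiser: `mem_levelTower_iff_valued_le_pow_uniformizer`), and `f = 2` a theorem of `(hone, hdeg)`. STILL IN
WORDS: that the real `v₁` has `e = 1` (the datum); the ideal identity `𝔭_{v₁}^n 𝓞_{E,w} = 𝔪_w^n` for the valuation ring
of the completion as an `Ideal.map` statement (plan-3 STATUS l. 16127 (3): here the two descriptions of the level are
shown to agree on base elements and, through the uniformiser, on every element of `E_w`); «`σ` generates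
`Gal(E_w/K_{v₁})`» (consumed by no clause); the identification (a′).
Nothing here is about (N), (P), the real `X`, or HC_CM; §8(d): NO. Blind lane: Mathlib + the HodgeRepro2 prefix;
no sorry; axioms ⊆ {propext, Classical.choice, Quot.sound}.
-/

namespace Summit.Ventures.HodgeRepro2.Tier7.Line3.InertLevelBase

open IsDedekindDomain IsDedekindDomain.HeightOneSpectrum NumberField WithZero
  Summit.Ventures.HodgeRepro2.Tier7.Line3.LevelTowerTopology
  Summit.Ventures.HodgeRepro2.Tier7.Line3.CongruenceSubgroup
  Summit.Ventures.HodgeRepro2.Tier7.Line3.AdicCompletionLevel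
  Summit.Ventures.HodgeRepro2.Tier7.Line3.AdicCompletionRestriction
open scoped NumberField WithZero

variable {K E : Type*} [Field K] [NumberField K] [Field E] [NumberField E] [Algebra K E]
  (v : HeightOneSpectrum (𝓞 K)) (w : HeightOneSpectrum (𝓞 E)) [w.asIdeal.LiesOver v.asIdeal]

/-! ## `e = 1`: the valuation of a base integer is unchanged -/

/-- **at `e = 1` the `w`-adic valuation of a base integer is its `v`-adic valuation** — Mathlib's
`intValuation_liesOver` (`v.intValuation x ^ e = w.intValuation (algebraMap x)`, the general statement carries the
power `e`) specialised at `e = 1` (plan-3 STATUS l. 16127 (2)). -/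
theorem intValuation_algebraMap_eq (he : v.asIdeal.ramificationIdx' w.asIdeal = 1) (x : 𝓞 K) :
    w.intValuation (algebraMap (𝓞 K) (𝓞 E) x) = v.intValuation x := by
  rw [← intValuation_liesOver v w x, he, pow_one]

/-- **`𝔭_{v₁}^n 𝓞_E ∩ 𝓞_{E⁺} = 𝔭_{v₁}^n` at the global integers** (`e = 1`). -/
theorem mem_pow_iff (he : v.asIdeal.ramificationIdx' w.asIdeal = 1) (x : 𝓞 K) (n : ℕ) :
    algebraMap (𝓞 K) (𝓞 E) x ∈ w.asIdeal ^ n ↔ x ∈ v.asIdeal ^ n := by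
  rw [← Ideal.span_singleton_le_iff_mem, ← Ideal.dvd_iff_le, ← intValuation_le_pow_iff_dvd,
    intValuation_algebraMap_eq v w he, intValuation_le_pow_iff_dvd, Ideal.dvd_iff_le,
    Ideal.span_singleton_le_iff_mem]

/-! ## The level read from the base field -/

/-- **a base integer in the completion of `E` at `w` has `Valued.v ≤ exp (−n)` iff it lies in `𝔭_{v₁}^n`** (`e = 1`). -/
theorem valued_coe_le_pow_iff_base (he : v.asIdeal.ramificationIdx' w.asIdeal = 1) (x : 𝓞 K) (n : ℕ) :
    Valued.v ((algebraMap (𝓞 E) E (algebraMap (𝓞 K) (𝓞 E) x) : E) : w.adicCompletion E) ≤ exp (-(n : ℤ)) ↔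
      x ∈ v.asIdeal ^ n := by
  rw [valued_coe_le_pow_iff w, mem_pow_iff v w he]

/-- **the level tower at `q := q w` read in the base field**: for `g ∈ GL₂(E_w)` with `g − 1` the image of a matrix `m`
over `𝓞 K`, `g ∈ K_N ↔ m ≡ 0 (mod 𝔭_{v₁}^{N+1})` entrywise — the real datum's level `𝔭_{v₁}^{N+1}` IS the kernel's
`levelTower N` (`e = 1` DISPLAYED). Composed from `AdicCompletionLevel.mem_levelTower_iff` (p705534: the tower at
`q := q w` against Mathlib's NORMALISED norm IS the congruence tower in valuation form, `Valued.v ((g − 1) i j) ≤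
exp (−(N+1))`) and `valued_coe_le_pow_iff_base` (plan-3 STATUS l. 16127 (4)). This is the BASE-ENTRY sample of the
clause (entries of `g − 1` from `𝓞 K`); `mem_levelTower_iff_valued_le_pow_uniformizer` below is the general-entry
form through a base uniformiser (L1-p4 STATUS l. 16124 P1). -/
theorem mem_levelTower_iff_of_integral_base (he : v.asIdeal.ramificationIdx' w.asIdeal = 1) (N : ℕ)
    (g : GL (Fin 2) (w.adicCompletion E)) (m : Matrix (Fin 2) (Fin 2) (𝓞 K))
    (hm : ∀ i j, ((g : Matrix (Fin 2) (Fin 2) (w.adicCompletion E)) - 1) i j =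
      ((algebraMap (𝓞 E) E (algebraMap (𝓞 K) (𝓞 E) (m i j)) : E) : w.adicCompletion E)) :
    g ∈ levelTower normAbv isNonarchimedean_normAbv (one_lt_q w) N ↔
      ∀ i j, m i j ∈ v.asIdeal ^ (N + 1) := by
  rw [mem_levelTower_iff]
  exact forall₂_congr fun i j => by rw [hm i j, valued_coe_le_pow_iff_base v w he]

/-! ## The level through a base uniformiser: every `g ∈ GL₂(E_w)` (L1-p4 STATUS l. 16124 P1) -/

/-- **a uniformiser of `K` at `v` stays a uniformiser of `E_w`** (`e = 1`): `Valued.v (ϖ : E_w) = exp (−1)` for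
`ϖ ∈ 𝓞 K` with `v.intValuation ϖ = exp (−1)`. -/
theorem valued_uniformizer_eq (he : v.asIdeal.ramificationIdx' w.asIdeal = 1) (ϖ : 𝓞 K)
    (hϖ : v.intValuation ϖ = exp (-1 : ℤ)) :
    Valued.v ((algebraMap (𝓞 E) E (algebraMap (𝓞 K) (𝓞 E) ϖ) : E) : w.adicCompletion E) = exp (-1 : ℤ) := by
  rw [valuedAdicCompletion_eq_valuation', valuation_of_algebraMap, intValuation_algebraMap_eq v w he, hϖ]

/-- **the level tower at `q := q w` through a base uniformiser, for EVERY `g ∈ GL₂(E_w)`**: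
`g ∈ K_N ↔ ∀ i j, Valued.v ((g − 1) i j) ≤ Valued.v (ϖ : E_w) ^ (N+1)` — «`g ≡ 1 (mod 𝔭_{v₁}^{N+1} 𝓞_{E,w})`» read
through the base uniformiser `ϖ`, with no integrality restriction on the entries (`e = 1` DISPLAYED; L1-p4 STATUS
l. 16124 P1). -/
theorem mem_levelTower_iff_valued_le_pow_uniformizer (he : v.asIdeal.ramificationIdx' w.asIdeal = 1) (ϖ : 𝓞 K)
    (hϖ : v.intValuation ϖ = exp (-1 : ℤ)) (N : ℕ) (g : GL (Fin 2) (w.adicCompletion E)) :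
    g ∈ levelTower normAbv isNonarchimedean_normAbv (one_lt_q w) N ↔
      ∀ i j, Valued.v (((g : Matrix (Fin 2) (Fin 2) (w.adicCompletion E)) - 1) i j) ≤
        Valued.v ((algebraMap (𝓞 E) E (algebraMap (𝓞 K) (𝓞 E) ϖ) : E) : w.adicCompletion E) ^ (N + 1) := by
  rw [mem_levelTower_iff, valued_uniformizer_eq v w he ϖ hϖ, ← exp_nsmul]
  simp only [nsmul_eq_mul, mul_neg, mul_one]

/-! ## `q w = N(v)^f`, and `f = 2` at the inert place of a quadratic extension -/

/-- **the residue cardinality of `E` at `w` is the `f`-th power of the residue cardinality of `K` at `v`.** -/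
theorem q_eq_pow_inertiaDeg : q w = (q v) ^ w.asIdeal.inertiaDeg (𝓞 K) := by
  have h := absNorm_eq_pow v w
  unfold q
  exact_mod_cast congrArg NNReal.toReal h

/-- **one prime above `v`, `e = 1`, `[E : K] = 2` ⇒ `f = 2`** (the fundamental identity `e · f = [E : K]`). -/
theorem inertiaDeg_eq_two (he : v.asIdeal.ramificationIdx' w.asIdeal = 1)
    (hone : (Ideal.primesOver v.asIdeal (𝓞 E)).ncard = 1) (hdeg : Module.finrank K E = 2) :
    w.asIdeal.inertiaDeg (𝓞 K) = 2 := by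
  have h := localDeg_eq_finrank v w hone
  rw [localDeg, he, one_mul, hdeg] at h
  exact h

/-- **`q w = (q v)²` at the inert place of a quadratic extension.** -/
theorem q_eq_sq (he : v.asIdeal.ramificationIdx' w.asIdeal = 1)
    (hone : (Ideal.primesOver v.asIdeal (𝓞 E)).ncard = 1) (hdeg : Module.finrank K E = 2) :
    q w = (q v) ^ 2 := by
  rw [q_eq_pow_inertiaDeg v w, inertiaDeg_eq_two v w he hone hdeg]

end Summit.Ventures.HodgeRepro2.Tier7.Line3.InertLevelBase
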